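import Literature.NumberTheory.EllipticCurves.NewformsMainLemma
import Literature.NumberTheory.EllipticCurves.NewformsMainLemmaSlashRep
import Literature.NumberTheory.EllipticCurves.NewformsMainLemmaGenerators
import Literature.NumberTheory.EllipticCurves.NewformsSpanGamma1Proofs
import Literature.NumberTheory.EllipticCurves.HeckeOperatorsGamma1QExpansionProofs
import Literature.NumberTheory.EllipticCurves.HeckeOperatorsProofs
import Literature.RepresentationTheory.FiniteGroups.CommutingFixedPoints
import HarnessLib

/-!
# The Main Lemma of Atkin–Lehner theory for `Γ₁(N)` (Diamond–Shurman Thm. 5.7.1): Carlton's proof,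
# and multiplicity one for `S_k(Γ₁(N))^{new}` (Thm. 5.8.2; Li 1975)

This file discharges two named facts of the tree:

* `atkinLehnerMainLemma1_holds : atkinLehnerMainLemma1 N k` (`NewformsMainLemma`;
  Diamond–Shurman, *A first course in modular forms*, GTM 228, Thm. 5.7.1, PDF p. 211): if
  `f ∈ S_k(Γ₁(N))` has `a_n(f) = 0` for all `n ≥ 1` prime to `N`, then
  `f = ∑_{p ∣ N} ι_p f_p` with `f_p ∈ S_k(Γ₁(N/p))`;
* `span_newforms1_holds : span_newforms1 N k` (`Newforms`; Li 1975, Thm. 3 / Cor. 3,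
  Diamond–Shurman Thm. 5.8.2): the newforms span `S_k(Γ₁(N))^{new}` — by
  `span_newforms1_of_mainLemma1` (`NewformsSpanGamma1Proofs`), which proved it from the Main Lemma.

## The proof of Thm. 5.7.1 (Carlton's argument as printed in Diamond–Shurman §5.7, pp. 211–216)

All in the `Γ(N)`-picture: `SL(2, ℤ)` acts on `S_k(Γ(N))` by `ρ(γ) F = F ∣[k] γ⁻¹`
(`slashRep`, `NewformsMainLemmaSlashRep`), through the finite group `SL(2, ℤ/Nℤ)`.

1. *First reduction* (Lemma 5.7.2, p. 212). `Θ f = f ∣[k] δ_N`, `δ_N = diag(1, N)`, is a cusp form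
   of level `Γ(N)` invariant under `Γ¹(N) ∋ L = (1 0; 1 1)` (`thetaUp`, `thetaUp_slash_eq_self`);
   its period-`N` coefficients are `N⁻¹ a_n(f)` (`coeff_thetaUp`).
2. *Second reduction* (p. 213). The projections `π_p = p⁻¹ ∑_{b mod p} ρ(T^{-bN/p})` (`projT`) act
   on period-`N` expansions by `a_n ↦ 𝟙_{p ∣ n} a_n` (`coeff_projT`, a geometric sum of `p`-th
   roots of unity, Exercise 5.7.3) and have image fixed by `T^{N/p}` (`projT_mem_fixedSubmodule`,
   Lemma 5.7.4). Peeling off `π_q G` prime by prime (`exists_sum_eq_of_coeff_eq_zero`, the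
   inclusion `ker ∏(1 - π_p) ⊆ ∑ im π_p` of Exercise 5.7.4, which needs no commutativity in this
   form) gives `Θ f = ∑_{p ∣ N} u_p` with `u_p` fixed by `K_p = ⟨T^{N/p}⟩`
   (`exists_sum_eq_thetaUp`).
3. *Third version* (Thm. 5.7.5, (5.17), Prop. 5.7.7, pp. 213–215). With `H_q = ⟨L^{N/q^{v_q}}⟩`
   (`subH`; `Θ f` is fixed by every `H_q`) and `K_p` as above (`subK`), the operators attached to
   distinct primes commute modulo `Γ(N)` (`commute_slashRep_of_ne`, from
   `commutator_T_zpow_matL_zpow_mem_Gamma` of `NewformsMainLemmaGenerators`), so Carlton's lemma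
   in the general form proved in `Literature.RepresentationTheory.FiniteGroups.CommutingFixedPoints`
   (`exists_sum_eq_of_mem_fixedSubmodule`: Prop. 5.7.7 for an arbitrary representation) refines
   the decomposition to `Θ f = ∑_p w_p` with `w_p` fixed by `T^{N/p}` and by every `L^{N/q^{v_q}}`,
   hence by `L` (`matL_mem_biSup_zpowers`, `gcd_q N/q^{v_q} = 1`) (`exists_sum_eq_thetaUp_fixed`).
4. *Lemma 5.7.6* (pp. 214–216, `gammaUpper1_le_of_mem` of `NewformsMainLemmaGenerators`): a
   vector fixed by `Γ(N)`, `T^{N/p}` and `L` is fixed by `Γ¹(N/p)` (`gammaUpper1_le_stabilizer`),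
   so `w_p ∣[k] δ_{N/p}⁻¹ ∈ S_k(Γ₁(N/p))` (`thetaDown`), and `ι_p` corresponds to the inclusion
   `S_k(Γ¹(N/p)) ⊆ S_k(Γ¹(N))` (the diagram of p. 212; `iota_slash_deltaGL`), which assembles
   `f = ∑_p ι_p f_p` with `f_p = p · (w_p ∣[k] δ_{N/p}⁻¹)` (`atkinLehnerMainLemma1_holds`).

No new named facts are introduced (D-0026): every intermediate statement is proved here.

## References

* F. Diamond, J. Shurman, *A first course in modular forms*, GTM 228, Springer 2005, §5.7
  (Thm. 5.7.1, Lemma 5.7.2, Thm. 5.7.3, Lemma 5.7.4, Thm. 5.7.5, Lemma 5.7.6, Prop. 5.7.7,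
  PDF pp. 211–216) and Thm. 5.8.2 (pp. 216–218). doi:10.1007/978-0-387-27226-9
* D. Carlton, *On a result of Atkin and Lehner*, arXiv:math/9910027 (1999) ([Car99] of
  Diamond–Shurman); *Moduli for pairs of elliptic curves with isomorphic `N`-torsion*,
  Manuscripta Math. 105 (2001) ([Car01]).
* A. O. L. Atkin, J. Lehner, *Hecke operators on `Γ₀(m)`*, Math. Ann. 185 (1970), 134–160.
* W.-C. W. Li, *Newforms and functional equations*, Math. Ann. 212 (1975), 285–315, Thm. 3, Cor. 3.
-/

noncomputable section

open scoped MatrixGroups ModularForm Real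

open CongruenceSubgroup UpperHalfPlane Matrix.SpecialLinearGroup Function

namespace Literature.NumberTheory.EllipticCurves.ModularForms

namespace MainLemmaCarlton

variable (N : ℕ) [NeZero N] (k : ℤ)

omit [NeZero N] in
/-- `N` is a strict period of `Γ(N)`. [folklore] -/
lemma natCast_mem_strictPeriods_Gamma :
    (N : ℝ) ∈ (Gamma N : Subgroup (GL (Fin 2) ℝ)).strictPeriods := by
  rw [strictPeriods_Gamma]
  exact AddSubgroup.mem_zmultiples _

/-- `0 < N` in `ℝ`. [folklore] -/
lemma natCast_pos' : (0 : ℝ) < N := Nat.cast_pos.mpr (NeZero.pos N)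

/-- The period-`N` `q`-expansion of `G ∈ S_k(Γ(N))` converges to `G`. [folklore] -/
lemma hasSum_qExpansion_Gamma (G : CuspForm (Gamma N) k) (τ : ℍ) :
    HasSum (fun m ↦ (qExpansion N ⇑G).coeff m • Periodic.qParam N τ ^ m) (G τ) :=
  hasSum_qExpansion (natCast_pos' N)
    (SlashInvariantFormClass.periodic_comp_ofComplex G (natCast_mem_strictPeriods_Gamma N))
    (ModularFormClass.holo G) (ModularFormClass.bdd_at_infty G) τ

/-- Uniqueness of period-`N` coefficients for `G ∈ S_k(Γ(N))`. [folklore] -/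
lemma qExpansion_coeff_eq_of_hasSum (G : CuspForm (Gamma N) k) {c : ℕ → ℂ}
    (hc : ∀ τ : ℍ, HasSum (fun m ↦ c m • Periodic.qParam N τ ^ m) (G τ)) (m : ℕ) :
    (qExpansion N ⇑G).coeff m = c m :=
  (ModularFormClass.qExpansion_coeff_unique (natCast_pos' N)
    (natCast_mem_strictPeriods_Gamma N) (f := G) hc m).symm

/-- A cusp form of level `Γ(N)` all of whose period-`N` coefficients vanish is zero. [folklore] -/
lemma eq_zero_of_forall_coeff_eq_zero (G : CuspForm (Gamma N) k)
    (h : ∀ m, (qExpansion N ⇑G).coeff m = 0) : G = 0 := by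
  have hq : qExpansion N ⇑G = 0 := by ext m; simp [h m]
  have := (qExpansion_eq_zero_iff (natCast_pos' N)
    (SlashInvariantFormClass.periodic_comp_ofComplex G (natCast_mem_strictPeriods_Gamma N))
    (ModularFormClass.holo G) (ModularFormClass.bdd_at_infty G)).mp hq
  exact DFunLike.coe_injective (this.trans CuspForm.coe_zero.symm)

/-! ### Coefficients of translates `G ∣[k] Tᵐ` -/

omit [NeZero N] in
/-- `q_N(τ + m) ^ n = e^{2πi m n / N} q_N(τ)^n`. [folklore] -/
lemma qParam_vadd_pow (m : ℤ) (τ : ℍ) (n : ℕ) :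
    Periodic.qParam N (((m : ℝ) +ᵥ τ : ℍ) : ℂ) ^ n =
      Complex.exp (2 * π * Complex.I * m * n / N) * Periodic.qParam N (τ : ℂ) ^ n := by
  simp only [Periodic.qParam, coe_vadd, ← Complex.exp_nat_mul, ← Complex.exp_add]
  congr 1
  push_cast
  ring

/-- `(G ∣[k] Tᵐ)(τ) = G(τ + m)`. [folklore] -/
lemma slash_T_zpow_apply (G : ℍ → ℂ) (m : ℤ) (τ : ℍ) :
    (G ∣[k] (ModularGroup.T ^ m)) τ = G ((m : ℝ) +ᵥ τ) := by
  rw [ModularForm.SL_slash_apply, ModularGroup.denom_apply, modular_T_zpow_smul]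
  simp [ModularGroup.coe_T_zpow]

omit [NeZero N] in
/-- `ρ(T^{-m}) G = G ∣[k] Tᵐ` as functions. [folklore] -/
lemma coe_slashRep_T_zpow_neg (G : CuspForm (Gamma N) k) (m : ℤ) :
    (⇑(slashRep N k (ModularGroup.T ^ (-m)) G) : ℍ → ℂ) = ⇑G ∣[k] (ModularGroup.T ^ m) := by
  rw [coe_slashRep, zpow_neg, inv_inv]

/-- **Coefficients of a translate**: `a_n(G ∣[k] Tᵐ) = e^{2πi m n/N} a_n(G)` for the period-`N`
expansion of `G ∈ S_k(Γ(N))` (Diamond–Shurman §5.7, p. 213). [cite: DiamondShurman2005, §5.7 p. 213] -/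
lemma coeff_slashRep_T_zpow_neg (G : CuspForm (Gamma N) k) (m : ℤ) (n : ℕ) :
    (qExpansion N ⇑(slashRep N k (ModularGroup.T ^ (-m)) G)).coeff n =
      Complex.exp (2 * π * Complex.I * m * n / N) * (qExpansion N ⇑G).coeff n := by
  refine qExpansion_coeff_eq_of_hasSum N k (slashRep N k (ModularGroup.T ^ (-m)) G)
    (c := fun n ↦ Complex.exp (2 * π * Complex.I * m * n / N) * (qExpansion N ⇑G).coeff n)
    (fun τ ↦ ?_) n
  rw [coe_slashRep_T_zpow_neg, slash_T_zpow_apply]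
  have h := hasSum_qExpansion_Gamma N k G ((m : ℝ) +ᵥ τ)
  simp only [qParam_vadd_pow, smul_eq_mul] at h ⊢
  convert h using 1
  funext n'
  ring

/-! ### Coefficients of `Θ f = f ∣[k] δ_N` -/

/-- `δ_N • τ = τ / N` (as a complex number). [folklore] -/
lemma coe_deltaGL_smul (τ : ℍ) :
    ((glCast (deltaGL N : GL (Fin 2) ℚ) • τ : ℍ) : ℂ) = (τ : ℂ) / N := by
  rw [coe_smul_of_det_pos (det_glCast_pos _), num, denom, coe_glCast_deltaGL]
  simp

/-- `(f ∣[k] δ_N)(τ) = N⁻¹ f(τ/N)`. [folklore] -/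
lemma slash_deltaGL_apply (f : ℍ → ℂ) (τ : ℍ) :
    (f ∣[k] glCast (deltaGL N : GL (Fin 2) ℚ)) τ =
      (N : ℂ)⁻¹ * f (glCast (deltaGL N : GL (Fin 2) ℚ) • τ) := by
  have hN : (0 : ℝ) < N := natCast_pos' N
  have hdet : (glCast (deltaGL N : GL (Fin 2) ℚ)).det.val = (N : ℝ) := by
    rw [Matrix.GeneralLinearGroup.val_det_apply, coe_glCast_deltaGL, Matrix.det_fin_two_of]
    ring
  have hdenom : denom (glCast (deltaGL N : GL (Fin 2) ℚ)) τ = (N : ℂ) := by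
    rw [denom, coe_glCast_deltaGL]
    simp
  rw [ModularForm.slash_apply, σ_glCast, hdet, hdenom, abs_of_pos hN, Complex.ofReal_natCast,
    mul_assoc,
    ← zpow_add₀ (by exact_mod_cast (NeZero.ne N) : (N : ℂ) ≠ 0),
    show k - 1 + -k = -1 by ring, zpow_neg_one, mul_comm]

/-- `q_1(τ/N)^n = q_N(τ)^n`. [folklore] -/
lemma qParam_one_deltaGL_smul_pow (τ : ℍ) (n : ℕ) :
    Periodic.qParam 1 (((glCast (deltaGL N : GL (Fin 2) ℚ) • τ : ℍ) : ℂ)) ^ n =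
      Periodic.qParam N (τ : ℂ) ^ n := by
  rw [coe_deltaGL_smul]
  simp only [Periodic.qParam]
  congr 2
  push_cast
  ring

/-- **Coefficients of `Θ f`**: the period-`N` coefficients of `Θ f = f ∣[k] δ_N ∈ S_k(Γ(N))` are
`N⁻¹ a_n(f)` (Diamond–Shurman p. 212: `[α_N⁻¹]_k` takes `∑ a_n qⁿ` to `∑ a_n q_Nⁿ` up to the
normalising constant). [cite: DiamondShurman2005, §5.7 p. 212] -/
lemma coeff_thetaUp (f : CuspForm (Gamma1 N) k) (n : ℕ) :
    (qExpansion N ⇑(thetaUp N k f)).coeff n = (N : ℂ)⁻¹ * (qExpansion 1 ⇑f).coeff n := by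
  refine qExpansion_coeff_eq_of_hasSum N k (thetaUp N k f)
    (c := fun n ↦ (N : ℂ)⁻¹ * (qExpansion 1 ⇑f).coeff n) (fun τ ↦ ?_) n
  rw [coe_thetaUp, slash_deltaGL_apply]
  have h := HeckeTGamma1.hasSum_qExpansion_Gamma1 N k f (glCast (deltaGL N : GL (Fin 2) ℚ) • τ)
  simp only [qParam_one_deltaGL_smul_pow, smul_eq_mul] at h ⊢
  have h2 := h.mul_left ((N : ℂ)⁻¹)
  simp only [← mul_assoc] at h2
  exact h2


/-! ### The projections `π_p` (Diamond–Shurman p. 213) -/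

/-- `u_p = ρ(T^{-N/p})`, i.e. `u_p G = G ∣[k] T^{N/p}` (`τ ↦ τ + N/p`); local notation
`uT[N, k, p]` (not a declaration). [folklore] -/
local notation "uT[" N ", " k ", " p "]" =>
  slashRep N k (ModularGroup.T ^ (-((N / p : ℕ) : ℤ)))

/-- **The projection `π_p`** of Diamond–Shurman p. 213 (there on `q_N`-expansions:
`π_d (∑ a_n q_Nⁿ) = ∑_{d ∣ n} a_n q_Nⁿ`): `π_p = p⁻¹ ∑_{b mod p} u_p^b`, the average of
`G ↦ G ∣[k] (1 bN/p; 0 1)`; local notation `πT[N, k, p]` (not a declaration). [cite: DiamondShurman2005, §5.7 p. 213] -/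
local notation "πT[" N ", " k ", " p "]" =>
  ((p : ℂ)⁻¹ • ∑ b ∈ Finset.range p, (uT[N, k, p]) ^ b : Module.End ℂ (CuspForm (Gamma N) k))

omit [NeZero N] in
/-- `u_p^b = ρ(T^{-(N/p) b})`. [folklore] -/
lemma uOp_pow (p b : ℕ) :
    (uT[N, k, p]) ^ b = slashRep N k (ModularGroup.T ^ (-(((N / p : ℕ) : ℤ) * b))) := by
  rw [← map_pow, ← zpow_natCast, ← zpow_mul, neg_mul]

omit [NeZero N] in
/-- `Tᵐ ∈ Γ(N)` for `N ∣ m`. [folklore] -/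
lemma T_zpow_mem_Gamma {m : ℤ} (h : (N : ℤ) ∣ m) : ModularGroup.T ^ m ∈ Gamma N := by
  have hm : ((m : ℤ) : ZMod N) = 0 := (ZMod.intCast_zmod_eq_zero_iff_dvd m N).mpr h
  rw [Gamma_mem, ModularGroup.coe_T_zpow]
  simp [hm]

omit [NeZero N] in
/-- `T^{-N}` acts trivially on `S_k(Γ(N))`. [folklore] -/
lemma slashRep_T_zpow_neg_N : slashRep N k (ModularGroup.T ^ (-(N : ℤ))) = 1 :=
  slashRep_eq_one_of_mem N k (T_zpow_mem_Gamma N (m := -(N : ℤ)) (dvd_neg.mpr dvd_rfl))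

omit [NeZero N] in
/-- `u_p^p = 1` for `p ∣ N`. [folklore] -/
lemma uOp_pow_eq_one {p : ℕ} (hpN : p ∣ N) : (uT[N, k, p]) ^ p = 1 := by
  rw [uOp_pow, ← Nat.cast_mul, Nat.div_mul_cancel hpN]
  exact slashRep_T_zpow_neg_N N k

omit [NeZero N] in
/-- `u_p π_p = π_p` (`π_p` averages over the cyclic group generated by `u_p`). [folklore] -/
lemma uOp_mul_projT {p : ℕ} (hpN : p ∣ N) : uT[N, k, p] * πT[N, k, p] = πT[N, k, p] := by
  have h := mul_geom_sum (uT[N, k, p]) p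
  rw [uOp_pow_eq_one N k hpN, sub_self, sub_mul, one_mul, sub_eq_zero] at h
  rw [mul_smul_comm, h]

omit [NeZero N] in
/-- `ρ(T^{N/p})` fixes the image of `π_p` (Diamond–Shurman p. 213: `im π_p = S_k(Γ_p)`,
`Γ_p/Γ(N)` generated by `(1 N/p; 0 1)`, Lemma 5.7.4). [cite: DiamondShurman2005, §5.7 p. 213] -/
lemma slashRep_T_pow_projT {p : ℕ} (hpN : p ∣ N) (G : CuspForm (Gamma N) k) :
    slashRep N k (ModularGroup.T ^ (N / p)) (πT[N, k, p] G) = πT[N, k, p] G := by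
  have h1 : uT[N, k, p] (πT[N, k, p] G) = πT[N, k, p] G := by
    rw [← Module.End.mul_apply, uOp_mul_projT N k hpN]
  calc slashRep N k (ModularGroup.T ^ (N / p)) (πT[N, k, p] G)
      = slashRep N k (ModularGroup.T ^ (N / p)) (uT[N, k, p] (πT[N, k, p] G)) := by rw [h1]
    _ = (slashRep N k (ModularGroup.T ^ (N / p)) * uT[N, k, p]) (πT[N, k, p] G) := rfl
    _ = πT[N, k, p] G := by
        rw [← map_mul, ← zpow_natCast, ← zpow_add, add_neg_cancel, zpow_zero, map_one,
          Module.End.one_apply]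

omit [NeZero N] in
/-- The image of `π_p` lies in the fixed space of `⟨T^{N/p}⟩`. [cite: DiamondShurman2005, §5.7 p. 213] -/
lemma projT_mem_fixedSubmodule {p : ℕ} (hpN : p ∣ N) (G : CuspForm (Gamma N) k) :
    πT[N, k, p] G ∈ Literature.NumberTheory.GaloisRepresentations.Representation.fixedSubmodule
      (slashRep N k) (Subgroup.zpowers (ModularGroup.T ^ (N / p))) := by
  rw [Literature.RepresentationTheory.FiniteGroups.Representation.mem_fixedSubmodule_iff_le,
    Subgroup.zpowers_le, Representation.mem_stabilizerSubgroup]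
  exact slashRep_T_pow_projT N k hpN G

/-- `e^{2πi (N/p) b n / N} = μ_p^{n b}` with `μ_p = e^{2πi/p}`, for `p ∣ N`. [folklore] -/
lemma exp_eq_pow {p : ℕ} (hp : 0 < p) (hpN : p ∣ N) (b n : ℕ) :
    Complex.exp (2 * π * Complex.I * ((((N / p : ℕ) : ℤ) * b : ℤ) : ℂ) * n / N) =
      Complex.exp (2 * π * Complex.I / p) ^ (n * b) := by
  rw [← Complex.exp_nat_mul]
  congr 1
  have hp0 : (p : ℂ) ≠ 0 := Nat.cast_ne_zero.mpr hp.ne'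
  have hN0 : (N : ℂ) ≠ 0 := Nat.cast_ne_zero.mpr (NeZero.ne N)
  have hdiv : (((N / p : ℕ) : ℤ) : ℂ) = (N : ℂ) / p := by
    rw [Int.cast_natCast, Nat.cast_div hpN hp0]
  rw [Int.cast_mul, hdiv, Int.cast_natCast]
  push_cast
  field_simp

/-- **Coefficients of `π_p G`** (Diamond–Shurman p. 213 and Exercise 5.7.3: "`π_d` preserves the
terms whose indices are multiples of `d` and kills everything else"): for a prime `p ∣ N`,
`a_n(π_p G) = 𝟙_{p ∣ n} a_n(G)`. [cite: DiamondShurman2005, §5.7 p. 213] -/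
lemma coeff_projT {p : ℕ} (hp : p.Prime) (hpN : p ∣ N) (G : CuspForm (Gamma N) k) (n : ℕ) :
    (qExpansion N ⇑(πT[N, k, p] G)).coeff n =
      (if p ∣ n then 1 else 0) * (qExpansion N ⇑G).coeff n := by
  have hp0 : (p : ℂ) ≠ 0 := Nat.cast_ne_zero.mpr hp.ne_zero
  -- the `n`-th period-`N` coefficient as a linear functional
  let Lc : CuspForm (Gamma N) k →ₗ[ℂ] ℂ :=
    { toFun := fun G ↦ (qExpansion N ⇑G).coeff n
      map_add' := fun G H ↦ by
        rw [CuspForm.coe_add, ModularForm.qExpansion_add (natCast_pos' N)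
          (natCast_mem_strictPeriods_Gamma N) G H, map_add]
      map_smul' := fun c G ↦ by
        rw [CuspForm.IsGLPos.coe_smul, ModularForm.qExpansion_smul (natCast_pos' N)
          (natCast_mem_strictPeriods_Gamma N) c G, map_smul, RingHom.id_apply] }
  have hLc : ∀ G : CuspForm (Gamma N) k, (qExpansion N ⇑G).coeff n = Lc G := fun G ↦ rfl
  rw [hLc, LinearMap.smul_apply, LinearMap.sum_apply, map_smul, map_sum]
  simp only [uOp_pow, ← hLc, coeff_slashRep_T_zpow_neg, exp_eq_pow N hp.pos hpN, smul_eq_mul]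
  rw [← Finset.sum_mul, Finset.sum_range (fun b ↦ Complex.exp (2 * π * Complex.I / p) ^ (n * b)),
    HeckeTGamma1.sum_exp_pow_mul hp n]
  split_ifs with h
  · field_simp
  · simp

/-- `a_n(G - H) = a_n(G) - a_n(H)`. [folklore] -/
lemma coeff_sub (G H : CuspForm (Gamma N) k) (n : ℕ) :
    (qExpansion N ⇑(G - H)).coeff n = (qExpansion N ⇑G).coeff n - (qExpansion N ⇑H).coeff n := by
  rw [CuspForm.coe_sub, ModularForm.qExpansion_sub (natCast_pos' N)
    (natCast_mem_strictPeriods_Gamma N) G H, map_sub]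

/-! ### Second reduction: `ker π ⊆ ∑_p im π_p` (Diamond–Shurman p. 213, Exercise 5.7.4) -/

/-- **`ker π ⊆ ∑_{p} im(π_p)`, coefficient form** (Diamond–Shurman p. 213: the hypothesis of the
Main Lemma says `f ∈ ker π`, `π = ∏_p (1 - π_p)`, and `ker π = ∑_p im π_p ⊆ ∑_p S_k(Γ_p)`): if
the period-`N` coefficients `a_n(G)` of `G ∈ S_k(Γ(N))` vanish for every `n` divisible by no
prime of `s` (a set of prime divisors of `N`), then `G = ∑_{p ∈ s} u_p` with `u_p` fixed by
`T^{N/p}`. Proof by induction on `s`, peeling off `π_q G`. [cite: DiamondShurman2005, §5.7 p. 213] -/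
theorem exists_sum_eq_of_coeff_eq_zero (s : Finset ℕ) (hs : ∀ p ∈ s, p.Prime ∧ p ∣ N)
    (G : CuspForm (Gamma N) k)
    (hG : ∀ n, (∀ p ∈ s, ¬ p ∣ n) → (qExpansion N ⇑G).coeff n = 0) :
    ∃ u : ℕ → CuspForm (Gamma N) k,
      (∀ p ∈ s, u p ∈ Literature.NumberTheory.GaloisRepresentations.Representation.fixedSubmodule
        (slashRep N k) (Subgroup.zpowers (ModularGroup.T ^ (N / p)))) ∧
      ∑ p ∈ s, u p = G := by
  classical
  induction s using Finset.induction_on generalizing G with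
  | empty =>
    refine ⟨0, by simp, ?_⟩
    rw [Finset.sum_empty, eq_comm]
    exact eq_zero_of_forall_coeff_eq_zero N k G fun n ↦ hG n (by simp)
  | insert q s hq IH =>
    have hqs := hs q (Finset.mem_insert_self q s)
    obtain ⟨u, hu, hsum⟩ := IH (fun p hp ↦ hs p (Finset.mem_insert_of_mem hp))
      (G - πT[N, k, q] G) (by
        intro n hn
        rw [coeff_sub, coeff_projT N k hqs.1 hqs.2]
        by_cases hqn : q ∣ n
        · simp [hqn]
        · rw [if_neg hqn, zero_mul, sub_zero]
          refine hG n fun p hp ↦ ?_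
          rcases Finset.mem_insert.mp hp with rfl | hp
          · exact hqn
          · exact hn p hp)
    refine ⟨Function.update u q (πT[N, k, q] G), ?_, ?_⟩
    · intro p hp
      rcases Finset.mem_insert.mp hp with rfl | hp
      · rw [Function.update_self]
        exact projT_mem_fixedSubmodule N k hqs.2 G
      · rw [Function.update_of_ne (fun h : p = q ↦ hq (h ▸ hp))]
        exact hu p hp
    · rw [Finset.sum_insert hq, Function.update_self,
        Finset.sum_congr rfl fun p hp ↦ Function.update_of_ne (fun h : p = q ↦ hq (h ▸ hp)) _ u,
        hsum, add_sub_cancel]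

/-- **The hypothesis of the Main Lemma in the `Γ(N)`-picture** (Diamond–Shurman p. 213,
`f ∈ S_k(Γ¹(N)) ∩ ker π ⊆ ∑_p S_k(Γ_p)`): if `a_n(f) = 0` for all `n ≥ 1` prime to `N`, then
`Θ f = ∑_{p ∣ N} u_p` with `u_p ∈ S_k(Γ(N))` fixed by `T^{N/p}`. [cite: DiamondShurman2005, Thm. 5.7.3 and p. 213] -/
theorem exists_sum_eq_thetaUp (f : CuspForm (Gamma1 N) k)
    (hf : ∀ n : ℕ, 0 < n → n.Coprime N → (qExpansion 1 ⇑f).coeff n = 0) :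
    ∃ u : ℕ → CuspForm (Gamma N) k,
      (∀ p ∈ N.primeFactors,
        u p ∈ Literature.NumberTheory.GaloisRepresentations.Representation.fixedSubmodule
          (slashRep N k) (Subgroup.zpowers (ModularGroup.T ^ (N / p)))) ∧
      ∑ p ∈ N.primeFactors, u p = thetaUp N k f := by
  refine exists_sum_eq_of_coeff_eq_zero N k N.primeFactors
    (fun p hp ↦ ⟨Nat.prime_of_mem_primeFactors hp, Nat.dvd_of_mem_primeFactors hp⟩) _ ?_
  intro n hn
  rcases Nat.eq_zero_or_pos n with rfl | hn0
  · exact CuspFormClass.qExpansion_coeff_zero (thetaUp N k f) (natCast_pos' N)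
      (natCast_mem_strictPeriods_Gamma N)
  · rw [coeff_thetaUp, hf n hn0 (Nat.coprime_of_dvd fun p hp hpn hpN ↦
      hn p (Nat.mem_primeFactors.mpr ⟨hp, hpN, NeZero.ne N⟩) hpn), mul_zero]

/-! ### Third version: the subgroups `H_q = ⟨L^{N/q^{v_q}}⟩`, `K_p = ⟨T^{N/p}⟩`; Carlton's lemma -/

/-- `H_q = ⟨L^{a_q}⟩ ≤ SL(2, ℤ)`, `a_q = N / q^{v_q(N)}` the prime-to-`q` part of `N`
(Diamond–Shurman p. 214, the subgroups `H_i`: modulo `Γ(N)`, `L^{a_q}` generates the `q`-part of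
`Γ¹`); local notation `H[N, q]` (not a declaration). [cite: DiamondShurman2005, §5.7 p. 214] -/
local notation "H[" N ", " q "]" =>
  (Subgroup.zpowers (matL ^ (N / q ^ Nat.factorization N q)) : Subgroup SL(2, ℤ))

/-- `K_p = ⟨T^{N/p}⟩ ≤ SL(2, ℤ)` (Diamond–Shurman p. 214, the subgroups `K_i`; Lemma 5.7.4:
`Γ_p = Γ₁(N) ∩ Γ⁰(N/p)` is generated by `Γ(N)` and `(1 N/p; 0 1)`); local notation `K[N, p]`
(not a declaration). [cite: DiamondShurman2005, §5.7 p. 214] -/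
local notation "K[" N ", " p "]" =>
  (Subgroup.zpowers (ModularGroup.T ^ (N / p)) : Subgroup SL(2, ℤ))

omit [NeZero N] in
/-- `H_q ⊔ K_q` is generated by `{L^{a_q}, T^{N/q}}`. [folklore] -/
lemma subH_sup_subK (q : ℕ) :
    H[N, q] ⊔ K[N, q] =
      Subgroup.closure {matL ^ (N / q ^ N.factorization q), ModularGroup.T ^ (N / q)} := by
  rw [Subgroup.zpowers_eq_closure, Subgroup.zpowers_eq_closure, ← Subgroup.closure_union,
    Set.singleton_union]

omit [NeZero N] in
/-- `ρ(Lᵃ)` and `ρ(Tᵇ)` commute when `N ∣ a b` (commutator in `Γ(N)`). [folklore] -/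
lemma commute_slashRep_matL_pow_T_pow {a b : ℕ} (h : N ∣ a * b) :
    Commute (slashRep N k (matL ^ a)) (slashRep N k (ModularGroup.T ^ b)) := by
  have h' : (N : ℤ) ∣ (a : ℤ) * (b : ℤ) := by exact_mod_cast h
  have := commute_slashRep_of_mem N k (commutator_T_zpow_matL_zpow_mem_Gamma (N := N) a b h')
  rw [zpow_natCast, zpow_natCast] at this
  exact this.symm

omit [NeZero N] in
/-- `q ∣ a_p = N / p^{v_p(N)}` for distinct primes `p, q` dividing `N`. [folklore] -/
lemma dvd_expL {p q : ℕ} (hp : p ∈ N.primeFactors) (hq : q ∈ N.primeFactors) (hne : p ≠ q) :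
    q ∣ N / p ^ N.factorization p := by
  have hpp := Nat.prime_of_mem_primeFactors hp
  have hqp := Nat.prime_of_mem_primeFactors hq
  have hqN := Nat.dvd_of_mem_primeFactors hq
  have hcop : Nat.Coprime q (p ^ N.factorization p) :=
    Nat.Coprime.pow_right _ ((Nat.coprime_primes hqp hpp).mpr (Ne.symm hne))
  have hN : p ^ N.factorization p * (N / p ^ N.factorization p) = N :=
    Nat.ordProj_mul_ordCompl_eq_self N p
  rw [← hN] at hqN
  exact hcop.dvd_of_dvd_mul_left hqN

omit [NeZero N] in
/-- `N ∣ a_p (N / q)` for distinct primes `p, q` dividing `N`. [folklore] -/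
lemma dvd_expL_mul_div {p q : ℕ} (hp : p ∈ N.primeFactors) (hq : q ∈ N.primeFactors)
    (hne : p ≠ q) : N ∣ N / p ^ N.factorization p * (N / q) := by
  obtain ⟨c, hc⟩ := dvd_expL N hp hq hne
  rw [hc, mul_comm q c, mul_assoc, Nat.mul_div_cancel' (Nat.dvd_of_mem_primeFactors hq)]
  exact Dvd.intro_left c rfl

omit [NeZero N] in
/-- **The operators attached to different primes commute** (Diamond–Shurman p. 214: the groups
`G_i = SL₂(ℤ/p_i^{e_i}ℤ)` commute inside `SL₂(ℤ/Nℤ) = ∏ G_i`; here: the generators `L^{a_p}`,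
`T^{N/p}` and `L^{a_q}`, `T^{N/q}` commute modulo `Γ(N)` for `p ≠ q`). [cite: DiamondShurman2005, §5.7 p. 214] -/
lemma commute_slashRep_of_ne {p q : ℕ} (hp : p ∈ N.primeFactors) (hq : q ∈ N.primeFactors)
    (hne : p ≠ q) :
    ∀ x ∈ H[N, p] ⊔ K[N, p], ∀ y ∈ H[N, q] ⊔ K[N, q],
      Commute (slashRep N k x) (slashRep N k y) := by
  rw [subH_sup_subK, subH_sup_subK]
  refine Literature.RepresentationTheory.FiniteGroups.Representation.commute_of_mem_closure
    (slashRep N k) fun x hx y hy ↦ ?_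
  rcases hx with rfl | rfl <;> rcases hy with rfl | rfl
  · rw [map_pow, map_pow]
    exact (Commute.refl _).pow_pow _ _
  · exact commute_slashRep_matL_pow_T_pow N k (dvd_expL_mul_div N hp hq hne)
  · exact (commute_slashRep_matL_pow_T_pow N k (dvd_expL_mul_div N hq hp (Ne.symm hne))).symm
  · rw [map_pow, map_pow]
    exact (Commute.refl _).pow_pow _ _

/-- `Θ f` is fixed by every `H_q` (it is `Γ¹(N)`-invariant, and `L ∈ Γ¹(N)`). [cite: DiamondShurman2005, Lemma 5.7.2] -/
lemma thetaUp_mem_fixedSubmodule_subH (f : CuspForm (Gamma1 N) k) (q : ℕ) :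
    thetaUp N k f ∈ Literature.NumberTheory.GaloisRepresentations.Representation.fixedSubmodule
      (slashRep N k) H[N, q] := by
  rw [Literature.NumberTheory.GaloisRepresentations.Representation.mem_fixedSubmodule,
    forall_slashRep_eq_iff]
  intro γ hγ
  have hγ' : γ ∈ gammaUpper1 N :=
    (Subgroup.zpowers_le.mpr ((gammaUpper1 N).pow_mem (matL_mem_gammaUpper1 N) _)) hγ
  exact thetaUp_slash_eq_self N k f γ hγ'.1 hγ'.2.1 hγ'.2.2

/-- **Carlton's lemma applied** (Diamond–Shurman Thm. 5.7.5 / (5.17) / Prop. 5.7.7, via the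
tree's `exists_sum_eq_of_mem_fixedSubmodule` for arbitrary representations): under the hypothesis
of the Main Lemma, `Θ f = ∑_{p ∣ N} w_p` with `w_p ∈ S_k(Γ(N))` fixed by `T^{N/p}` and by every
`L^{a_q}`, `q ∣ N`. [cite: DiamondShurman2005, Thm. 5.7.5 and Prop. 5.7.7] -/
theorem exists_sum_eq_thetaUp_fixed (f : CuspForm (Gamma1 N) k)
    (hf : ∀ n : ℕ, 0 < n → n.Coprime N → (qExpansion 1 ⇑f).coeff n = 0) :
    ∃ w : N.primeFactors → CuspForm (Gamma N) k,
      ∑ i : N.primeFactors, w i = thetaUp N k f ∧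
      ∀ i : N.primeFactors,
        w i ∈ Literature.NumberTheory.GaloisRepresentations.Representation.fixedSubmodule
          (slashRep N k) K[N, (i : ℕ)] ∧
        ∀ j : N.primeFactors,
          w i ∈ Literature.NumberTheory.GaloisRepresentations.Representation.fixedSubmodule
            (slashRep N k) H[N, (j : ℕ)] := by
  classical
  obtain ⟨u, hu, hsum⟩ := exists_sum_eq_thetaUp N k f hf
  have hsum' : ∑ i ∈ (Finset.univ : Finset N.primeFactors), u i = thetaUp N k f := by
    rw [← hsum, ← Finset.sum_coe_sort N.primeFactors u]
  obtain ⟨w, hwsum, hw⟩ :=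
    Literature.RepresentationTheory.FiniteGroups.Representation.exists_sum_eq_of_mem_fixedSubmodule
      (slashRep N k) (fun i : N.primeFactors ↦ H[N, (i : ℕ)]) (fun i ↦ K[N, (i : ℕ)])
      (fun i ↦ finite_image_slashRep N k _)
      (fun i j hij ↦ commute_slashRep_of_ne N k i.2 j.2 fun h ↦ hij (Subtype.ext h))
      Finset.univ (thetaUp N k f) (fun i ↦ u i)
      (fun i _ ↦ thetaUp_mem_fixedSubmodule_subH N k f i) (fun i _ ↦ hu i i.2) hsum'
  exact ⟨w, hwsum, fun i ↦ ⟨(hw i (Finset.mem_univ i)).1,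
    fun j ↦ (hw i (Finset.mem_univ i)).2 j (Finset.mem_univ j)⟩⟩

/-! ### Back to `Γ₁(N/p)`: Lemma 5.7.6 and the transport `θ↓` -/

/-- **From fixed vectors to `Γ¹(N/p)`-invariance** (Diamond–Shurman Lemma 5.7.6 via the tree's
`gammaUpper1_le_of_mem`, and `L ∈ ⨆_q ⟨L^{a_q}⟩` since `gcd_q a_q = 1`): a form `W ∈ S_k(Γ(N))`
fixed by `T^{N/p}` and by all `L^{a_q}` is fixed by `Γ¹(N/p)`. [cite: DiamondShurman2005, Lemma 5.7.6] -/
theorem gammaUpper1_le_stabilizer {p : ℕ} (hp : p ∈ N.primeFactors) (W : CuspForm (Gamma N) k)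
    (hK : W ∈ Literature.NumberTheory.GaloisRepresentations.Representation.fixedSubmodule
      (slashRep N k) K[N, p])
    (hH : ∀ q ∈ N.primeFactors,
      W ∈ Literature.NumberTheory.GaloisRepresentations.Representation.fixedSubmodule
        (slashRep N k) H[N, q]) :
    gammaUpper1 (N / p) ≤ Representation.stabilizerSubgroup (slashRep N k) W := by
  have hpr := Nat.prime_of_mem_primeFactors hp
  have hpN := Nat.dvd_of_mem_primeFactors hp
  refine gammaUpper1_le_of_mem (N / p) hpr ?_ ?_ ?_
  · rw [Nat.div_mul_cancel hpN]
    intro γ hγ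
    rw [Representation.mem_stabilizerSubgroup, slashRep_eq_one_of_mem N k hγ, Module.End.one_apply]
  · exact (Literature.RepresentationTheory.FiniteGroups.Representation.mem_fixedSubmodule_iff_le.mp
      hK) (Subgroup.mem_zpowers _)
  · have h2 : 2 ≤ N := hpr.two_le.trans (Nat.le_of_dvd (NeZero.pos N) hpN)
    have hL := matL_mem_biSup_zpowers N.primeFactors (fun q ↦ N / q ^ N.factorization q)
      (Nat.gcd_primeFactors_ordCompl_eq_one h2)
    have hle : (⨆ q ∈ N.primeFactors, Subgroup.zpowers (matL ^ (N / q ^ N.factorization q))) ≤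
        Representation.stabilizerSubgroup (slashRep N k) W :=
      iSup₂_le fun q hq ↦
        Literature.RepresentationTheory.FiniteGroups.Representation.mem_fixedSubmodule_iff_le.mp
          (hH q hq)
    exact hle hL

/-- Slash-invariance form of `gammaUpper1_le_stabilizer`, in the entrywise shape required by
`thetaDown`. [cite: DiamondShurman2005, Lemma 5.7.6] -/
theorem slash_eq_self_of_fixed {p : ℕ} (hp : p ∈ N.primeFactors) (W : CuspForm (Gamma N) k)
    (hK : W ∈ Literature.NumberTheory.GaloisRepresentations.Representation.fixedSubmodule
      (slashRep N k) K[N, p])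
    (hH : ∀ q ∈ N.primeFactors,
      W ∈ Literature.NumberTheory.GaloisRepresentations.Representation.fixedSubmodule
        (slashRep N k) H[N, q]) :
    ∀ γ : SL(2, ℤ), ((γ 0 0 : ℤ) : ZMod (N / p)) = 1 → ((γ 0 1 : ℤ) : ZMod (N / p)) = 0 →
      ((γ 1 1 : ℤ) : ZMod (N / p)) = 1 → (⇑W : ℍ → ℂ) ∣[k] γ = ⇑W := by
  intro γ h1 h2 h3
  have hle := gammaUpper1_le_stabilizer N k hp W hK hH
  exact (forall_slashRep_eq_iff N k (gammaUpper1 (N / p)) W).mp (fun δ hδ ↦ hle hδ) γ ⟨h1, h2, h3⟩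

/-! ### Slash algebra: `ι_p` versus the transports `δ_N`, `δ_{N/p}` -/

/-- `diag(p, 1) δ_N τ = δ_{N/p} τ` on `ℍ` (`p (τ/N) = τ/(N/p)`). [folklore] -/
lemma tpD_smul_deltaGL_smul {p : ℕ} [NeZero p] (hpN : p ∣ N) [NeZero (N / p)] (τ : ℍ) :
    tpD p • glCast (deltaGL N : GL (Fin 2) ℚ) • τ =
      glCast (deltaGL (N / p) : GL (Fin 2) ℚ) • τ := by
  apply UpperHalfPlane.ext
  have hp0 : (p : ℂ) ≠ 0 := Nat.cast_ne_zero.mpr (NeZero.ne p)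
  have hN0 : (N : ℂ) ≠ 0 := Nat.cast_ne_zero.mpr (NeZero.ne N)
  rw [coe_tpD_smul, coe_deltaGL_smul, coe_deltaGL_smul, Nat.cast_div hpN hp0]
  field_simp

/-- **`ι_p` and the transports**: `(p^{1-k} (p g)[α_p]_k)[δ_N]_k = g[δ_{N/p}]_k`, i.e.
Diamond–Shurman's commutative diagram p. 212 (`ι_p` on `Γ₁` corresponds to inclusion on `Γ¹`),
with the normalising constants of `[α_N⁻¹]_k`, `[α_{N/p}⁻¹]_k` made explicit. [cite: DiamondShurman2005, §5.7 p. 212] -/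
lemma iota_slash_deltaGL {p : ℕ} (hp : 0 < p) (hpN : p ∣ N) [NeZero (N / p)] (g : ℍ → ℂ) :
    ((p : ℂ) ^ (1 - k) • (((p : ℂ) • g) ∣[k]
        glCast (diagGL (p : ℚ) 1 (Nat.cast_pos.mpr hp) one_pos : GL (Fin 2) ℚ))) ∣[k]
      glCast (deltaGL N : GL (Fin 2) ℚ) = g ∣[k] glCast (deltaGL (N / p) : GL (Fin 2) ℚ) := by
  haveI : NeZero p := ⟨hp.ne'⟩
  have hp0 : (p : ℂ) ≠ 0 := Nat.cast_ne_zero.mpr hp.ne'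
  have hN0 : (N : ℂ) ≠ 0 := Nat.cast_ne_zero.mpr (NeZero.ne N)
  ext τ
  change (((p : ℂ) ^ (1 - k) • (((p : ℂ) • g) ∣[k] tpD p)) ∣[k]
    glCast (deltaGL N : GL (Fin 2) ℚ)) τ = _
  rw [slash_deltaGL_apply, Pi.smul_apply, slash_tpD_apply, Pi.smul_apply, slash_deltaGL_apply,
    tpD_smul_deltaGL_smul N hpN, smul_eq_mul, smul_eq_mul, ← mul_assoc ((p : ℂ) ^ (1 - k)),
    ← zpow_add₀ hp0, show (1 - k) + (k - 1) = 0 by ring, zpow_zero, one_mul, Nat.cast_div hpN hp0]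
  field_simp

end MainLemmaCarlton

/-! ### The Main Lemma -/

open MainLemmaCarlton in
/-- **Discharge of `atkinLehnerMainLemma1` — the Main Lemma of Atkin–Lehner theory for `Γ₁(N)`
(Diamond–Shurman Thm. 5.7.1)**, by Carlton's proof as printed in Diamond–Shurman §5.7:
transport to `S_k(Γ(N))` by `δ_N` (Lemma 5.7.2, `thetaUp`), the hypothesis `a_n(f) = 0` for
`(n, N) = 1` gives `Θ f ∈ ∑_p im π_p ⊆ ∑_p S_k(Γ(N))^{⟨T^{N/p}⟩}` (second version, p. 213,
`exists_sum_eq_thetaUp`), Carlton's lemma on fixed vectors of commuting finite actions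
(Thm. 5.7.5, Prop. 5.7.7; `exists_sum_eq_of_mem_fixedSubmodule` of
`Literature.RepresentationTheory.FiniteGroups.CommutingFixedPoints`) refines this to summands
fixed by `T^{N/p}` and `L`, Lemma 5.7.6 (`gammaUpper1_le_of_mem`) makes them
`Γ¹(N/p)`-invariant, and the transport back (`thetaDown`) lands in `S_k(Γ₁(N/p))`, the map `ι_p`
corresponding to the inclusion (p. 212, `iota_slash_deltaGL`). [cite: DiamondShurman2005, Thm. 5.7.1] -/
theorem atkinLehnerMainLemma1_holds (N : ℕ) [NeZero N] (k : ℤ) : atkinLehnerMainLemma1 N k := by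
  classical
  intro f hf
  obtain ⟨w, hwsum, hw⟩ := exists_sum_eq_thetaUp_fixed N k f hf
  have hZ : ∀ i : N.primeFactors, ∀ γ : SL(2, ℤ), ((γ 0 0 : ℤ) : ZMod (N / i)) = 1 →
      ((γ 0 1 : ℤ) : ZMod (N / i)) = 0 → ((γ 1 1 : ℤ) : ZMod (N / i)) = 1 →
      (⇑(w i) : ℍ → ℂ) ∣[k] γ = ⇑(w i) :=
    fun i ↦ slash_eq_self_of_fixed N k i.2 (w i) (hw i).1 fun q hq ↦ (hw i).2 ⟨q, hq⟩
  have hne : ∀ i : N.primeFactors, NeZero (N / (i : ℕ)) := fun i ↦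
    ⟨(Nat.div_pos (Nat.le_of_dvd (NeZero.pos N) (Nat.dvd_of_mem_primeFactors i.2))
      (Nat.pos_of_mem_primeFactors i.2)).ne'⟩
  let gd : ∀ i : N.primeFactors, CuspForm (Gamma1 (N / (i : ℕ))) k :=
    fun i ↦ @thetaDown k _ _ (w i) (N / (i : ℕ)) (hne i) (hZ i)
  refine ⟨fun p ↦ if hp : p ∈ N.primeFactors then ((p : ℂ) • gd ⟨p, hp⟩ :
    CuspForm (Gamma1 (N / p)) k) else 0, ?_⟩
  have hterm : ∀ i : N.primeFactors,
      ((((i : ℕ) : ℂ) ^ (1 - k)) • ((⇑(((i : ℕ) : ℂ) • gd i) : ℍ → ℂ) ∣[k]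
        glCast (diagGL ((i : ℕ) : ℚ) 1 (Nat.cast_pos.mpr (Nat.pos_of_mem_primeFactors i.2))
          one_pos : GL (Fin 2) ℚ))) ∣[k] glCast (deltaGL N : GL (Fin 2) ℚ) = ⇑(w i) := by
    intro i
    haveI := hne i
    rw [CuspForm.IsGLPos.coe_smul, iota_slash_deltaGL N k (Nat.pos_of_mem_primeFactors i.2)
      (Nat.dvd_of_mem_primeFactors i.2)]
    exact coe_thetaDown_slash (w i) (N / (i : ℕ)) (hZ i)
  have hsumfun : (⇑(thetaUp N k f) : ℍ → ℂ) = ∑ i : N.primeFactors, (⇑(w i) : ℍ → ℂ) := by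
    rw [← hwsum]
    exact map_sum CuspForm.coeHom _ _
  calc (⇑f : ℍ → ℂ) = ⇑(thetaUp N k f) ∣[k] (glCast (deltaGL N : GL (Fin 2) ℚ))⁻¹ :=
        coe_eq_thetaUp_slash_inv N k f
    _ = (∑ i : N.primeFactors, ((((i : ℕ) : ℂ) ^ (1 - k)) • ((⇑(((i : ℕ) : ℂ) • gd i) : ℍ → ℂ) ∣[k]
          glCast (diagGL ((i : ℕ) : ℚ) 1 (Nat.cast_pos.mpr (Nat.pos_of_mem_primeFactors i.2))
            one_pos : GL (Fin 2) ℚ))) ∣[k] glCast (deltaGL N : GL (Fin 2) ℚ)) ∣[k]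
          (glCast (deltaGL N : GL (Fin 2) ℚ))⁻¹ := by
        rw [hsumfun, Finset.sum_congr rfl fun i _ ↦ (hterm i).symm]
    _ = ∑ i : N.primeFactors, (((i : ℕ) : ℂ) ^ (1 - k)) • ((⇑(((i : ℕ) : ℂ) • gd i) : ℍ → ℂ) ∣[k]
          glCast (diagGL ((i : ℕ) : ℚ) 1 (Nat.cast_pos.mpr (Nat.pos_of_mem_primeFactors i.2))
            one_pos : GL (Fin 2) ℚ)) := by
        rw [← SlashAction.sum_slash, ← SlashAction.slash_mul, mul_inv_cancel, SlashAction.slash_one]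
    _ = _ := Finset.sum_congr rfl fun i _ ↦ by
        beta_reduce
        rw [dif_pos i.2]

/-- **Discharge of `span_newforms1` — multiplicity one for `Γ₁(N)`: the newforms span
`S_k(Γ₁(N))^{new}`** (Li 1975, Thm. 3 and Cor. 3; Diamond–Shurman Thm. 5.8.2, "The set of
newforms in the space `S_k(Γ₁(N))^{new}` is an orthogonal basis of the space"). Obtained from
`span_newforms1_of_mainLemma1` (`NewformsSpanGamma1Proofs`: Cor. 5.6.3 + Thm. 5.8.2(a), the proof
printed on PDF pp. 216–218) and the Main Lemma `atkinLehnerMainLemma1_holds` (Thm. 5.7.1) above.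
[cite: Li1975, Thm. 3 and Cor. 3] [cite: DiamondShurman2005, Thm. 5.8.2] -/
theorem span_newforms1_holds (N : ℕ) [NeZero N] (k : ℤ) : span_newforms1 N k :=
  span_newforms1_of_mainLemma1 N k (atkinLehnerMainLemma1_holds N k)

end Literature.NumberTheory.EllipticCurves.ModularForms

end
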